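import Mathlib
import Summits.Ventures.PercRepro.PuncturedLYMMixT1Q4Table1
import Summits.Ventures.PercRepro.PuncturedLYMMixT1Q4Table2

/-!
# PercRepro — (SP) FOR `1` PAIRWISE DISJOINT TRIPLES AND `4` PAIRWISE DISJOINT QUADRUPLES AT LEVEL `4`: POSITIVITY OF THE DENOMINATORS (1)
(p10, gen 41)

`den > 0`, `Pc > 0` for `n ≥ 19`; `Yc > 0` for `n ≥ 5`.  Nothing here asserts (SP).
-/

namespace PercRepro.PuncturedLYM.Split.TypeLift.MixT1Q4

/-- `den > 0` for `n ≥ 19`. -/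
theorem den_pos (n : ℚ) (hn : 19 ≤ n) : 0 < den n := by
  obtain ⟨n', hn', rfl⟩ : ∃ n', 0 ≤ n' ∧ n = 19 + n' := ⟨n - 19, by linarith, by ring⟩
  have h : den (19 + n') = 20736 * n' ^ 14 + 5076864 * n' ^ 13 + 576951120 * n' ^ 12 + 40337428320 * n' ^ 11 + 1938296309940 * n' ^ 10 + 67715812448436 * n' ^ 9 + 1773667039410936 * n' ^ 8 + 35383054054569240 * n' ^ 7 + 540212274631654212 * n' ^ 6 + 6281348714543069220 * n' ^ 5 + 54753217539867363072 * n' ^ 4 + 346943414130230650032 * n' ^ 3 + 1510646351409915530304 * n' ^ 2 + 4045601518455367931904 * n' + 5027416218463584780288 := by unfold den; ring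
  rw [h]; positivity

/-- `Yc > 0` for `n ≥ 5`. -/
theorem Yc_pos (n : ℚ) (hn : 5 ≤ n) : 0 < Yc n := by
  obtain ⟨n', hn', rfl⟩ : ∃ n', 0 ≤ n' ∧ n = 5 + n' := ⟨n - 5, by linarith, by ring⟩
  have h : Yc (5 + n') = (1 / 120) * n' ^ 5 + (1 / 8) * n' ^ 4 + (17 / 24) * n' ^ 3 + (15 / 8) * n' ^ 2 + (137 / 60) * n' + 1 := by unfold Yc; ring
  rw [h]; positivity

/-- `Pc > 0` for `n ≥ 19`. -/
theorem Pc_pos (n : ℚ) (hn : 19 ≤ n) : 0 < Pc n := by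
  obtain ⟨n', hn', rfl⟩ : ∃ n', 0 ≤ n' ∧ n = 19 + n' := ⟨n - 19, by linarith, by ring⟩
  have h : Pc (19 + n') = (1 / 24) * n' ^ 4 + (35 / 12) * n' ^ 3 + (1835 / 24) * n' ^ 2 + (10663 / 12) * n' + 3856 := by unfold Pc; ring
  rw [h]; positivity

end PercRepro.PuncturedLYM.Split.TypeLift.MixT1Q4
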